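import Summits.BirchSwinnertonDyer.Rank1Residual.Supersingular.KuriharaTwistIdentityPrelim
import Mathlib.Data.ZMod.Units
import Mathlib.FieldTheory.Finite.Basic
import Mathlib.Algebra.BigOperators.Field
import HarnessLib

/-!
# The plus symbol in CRT coordinates: the NORM (Hecke distribution) RELATION at a square-free level,
# for any 1-periodic `P : ℚ → ℚ` satisfying the Hecke relation at the level primes (KERNEL, abstract half
# of the "sibling file" left open in `KuriharaTwistIdentityBins.lean`)

Cell `b2b-bsdres`, supersingular family, prover A = unit `b2b-bsdres-x10b` (gen 10).  Topic file;
namespace `Summit.BirchSwinnertonDyer.Rank1Residual.Supersingular.KuriharaTwist.Identity` (that of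
n1011-p09's `DistSystem`).  TOOL THEOREMS of elementary algebra: no named fact, no elliptic curve, nothing
booked; marks unchanged.

HONEST FRAMING (run/shared/lean/b2b/bsd-rank1-residual/, verbatim in every file): the goal of the
cell is to DELETE the COMBINATION-SHAPED residual classes of the Birch–Swinnerton-Dyer formula for
ALL analytic-rank `≤ 1` elliptic curves over `ℚ` — "full BSD formula for every rank `≤ 1` curve in
class `C`" assembled STRICTLY from published theorems — so that the rank-`≤ 1` remainder becomes
exactly the CONSTRUCTION-SHAPED classes, which are TYPED (missing-input `Prop`s), NOT attempted.
This is not "finishing BSD".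

## What this file proves

n1011-p09's `KuriharaTwistIdentity*.lean` prove the bins-to-`δ̃` identity for every DISTRIBUTION SYSTEM
with eigenvalue `2` on a product `Π_i G_i` of finite abelian groups (`DistSystem`), and leave open "the
verification that the plus modular symbol of a newform … IS such a distribution system — the Hecke relation
read in CRT coordinates on `(ℤ/n)ˣ ≅ Π(ℤ/ℓ)ˣ`".  This file supplies the CRT-coordinate half for an
ARBITRARY function `P : ℚ → ℚ` that is `1`-periodic and satisfies the Hecke relation
`A_i · P(r) = Σ_{j mod ℓ_i} P((r + j)/ℓ_i) + P(ℓ_i r)` at finitely many distinct primes `ℓ_i` (for the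
rational plus symbol `[·]⁺_f` of a newform these are the tree theorems `ratPlusSymbol_add_intCast_eq` and
`intCast_mul_ratPlusSymbol`; the instantiation — a `DistSystem` valued in `ℤ/p^k` — is the sibling `KuriharaTwistSymbolDist.lean`):

* `levelOf ℓ U = Π_{i∈U} ℓ_i`; `crtWeight ℓ U i = (levelOf (U∖i))⁻¹ ∈ ℤ/ℓ_i`; the level-`U` ARGUMENT
  `levelArg ℓ U a = Σ_{i∈U} ((a_i · crtWeight U i).val)/ℓ_i ∈ ℚ` of a tuple `a ∈ Π_i (ℤ/ℓ_i)ˣ` — the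
  explicit Chinese-remainder representative: `levelOf U · levelArg U a ≡ a_i (mod ℓ_i)` for `i ∈ U`, so that
  `P(levelArg U a) = P(c/n_U)` for the CRT class `c` of `a` (`levelArg_eq_div_levelOf`: it is a fraction
  with denominator `levelOf U`); `frobElt ℓ i` = the tuple `(ℓ_i mod ℓ_j)_j` (coordinate `i` trivial).
* `sum_units_levelArg_update` (THE NORM RELATION in these coordinates): for `i ∈ U`, `U' = U∖i` and any
  tuple `c`,
  `Σ_{b ∈ (ℤ/ℓ_i)ˣ} P(levelArg U (c with c_i := b)) = A_i·P(levelArg U' c) − P(levelArg U' (ℓ_i·c)) − P(levelArg U' (ℓ_i⁻¹·c))`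
  — sum the Hecke relation at `r = levelArg U' c` over the fibre of multiplication by `ℓ_i` (the `ℓ_i`
  arguments `levelArg U (c, b)`, `b mod ℓ_i`, are EXACTLY `(r + u_b)/ℓ_i` with `u_b` running over a complete
  residue system, `exists_levelArgAt_eq`), shift the residue system (`sum_range_comp_add_of_periodic`), and
  remove the unique non-unit `b = 0`, whose argument is `levelArg U' (ℓ_i⁻¹·c)` (Mazur–Tate 1987 §1.3;
  Mazur–Tate–Teitelbaum 1986 §I.4 (4.2)).

No reduction modulo `p` happens here (everything is an identity of rational numbers); the `ℤ/p^k`-valued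
`DistSystem` and the identification with the tree's `kuriharaNumber` are the sibling files.

References: B. Mazur, J. Tate, Duke Math. J. 54 (1987) §1.3; Mazur–Tate–Teitelbaum, Invent. Math. 84
(1986) §I.4 (4.2); C.-H. Kim, arXiv:2203.12159 §1.4 [Kim2022StructureSelmer]; n1011-p09's
`KuriharaTwistIdentity{Prelim,,Bins}.lean`; HOME/b2b-bsdres-x10b/X6-KURIHARA.md §10.
-/

open Finset

namespace Summit.BirchSwinnertonDyer.Rank1Residual.Supersingular.KuriharaTwist.Identity

/-! ### §1 Two summation lemmas -/

section Sums

/-- A sum over a complete residue system does not depend on the shift: for `F : ℤ → M` with period `L`,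
`Σ_{j<L} F(T + j) = Σ_{j<L} F(j)` for every integer `T`. [folklore] -/
theorem sum_range_comp_add_of_periodic {M : Type*} [AddCommGroup M] (F : ℤ → M) (L : ℕ)
    (hF : ∀ z : ℤ, F (z + L) = F z) (T : ℤ) :
    ∑ j ∈ range L, F (T + j) = ∑ j ∈ range L, F j := by
  -- `S(T+1) = S(T)` for all `T`, then induction over `ℤ`
  have step : ∀ T : ℤ, ∑ j ∈ range L, F (T + 1 + j) = ∑ j ∈ range L, F (T + j) := by
    intro T
    have h1 : ∑ j ∈ range (L + 1), F (T + j) = ∑ j ∈ range L, F (T + ((j + 1 : ℕ) : ℤ)) + F (T + (0 : ℕ)) :=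
      Finset.sum_range_succ' (fun j => F (T + j)) L
    have h2 : ∑ j ∈ range (L + 1), F (T + j) = ∑ j ∈ range L, F (T + j) + F (T + (L : ℕ)) :=
      Finset.sum_range_succ (fun j => F (T + j)) L
    have h3 : ∑ j ∈ range L, F (T + ((j + 1 : ℕ) : ℤ)) = ∑ j ∈ range L, F (T + 1 + j) := by
      refine Finset.sum_congr rfl fun j _ => ?_
      push_cast; ring_nf
    have h4 : F (T + (L : ℕ)) = F (T + (0 : ℕ)) := by
      push_cast; rw [add_zero]; exact hF T
    rw [← h3]
    have := h1.symm.trans h2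
    rw [h4] at this
    exact add_right_cancel this
  induction T using Int.induction_on with
  | zero => simp
  | succ T ih => rw [step, ih]
  | pred T ih =>
    have h := step (-(T : ℤ) - 1)
    rw [show -(T : ℤ) - 1 + 1 = -(T : ℤ) by ring] at h
    rw [← ih, ← h]

variable {L : ℕ} [Fact L.Prime]

/-- Over the prime field `ℤ/L`: a sum over all residues is the value at `0` plus the sum over the units.
[folklore] -/
theorem sum_univ_eq_zero_add_sum_units {M : Type*} [AddCommMonoid M] (F : ZMod L → M) :
    ∑ b : ZMod L, F b = F 0 + ∑ u : (ZMod L)ˣ, F u := by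
  classical
  rw [← Finset.sum_erase_add _ _ (Finset.mem_univ (0 : ZMod L)), add_comm]
  congr 1
  refine Finset.sum_nbij' (fun b => if h : b = 0 then 1 else Units.mk0 b h) (fun u => (u : ZMod L))
    ?_ ?_ ?_ ?_ ?_
  · intro b _; exact Finset.mem_univ _
  · intro u _; exact Finset.mem_erase.2 ⟨u.ne_zero, Finset.mem_univ _⟩
  · intro b hb
    have hb0 : b ≠ 0 := (Finset.mem_erase.1 hb).1
    simp [hb0]
  · intro u _
    simp [u.ne_zero, Units.mk0_val]
  · intro b hb
    have hb0 : b ≠ 0 := (Finset.mem_erase.1 hb).1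
    simp [hb0]

/-- Over `ℤ/L`: `Σ_{b} G((b·w).val) = Σ_{j<L} G(j)` for a non-zero `w` (multiplication by `w` and `val`
are bijections onto `ℤ/L` and `{0,…,L−1}`). [folklore] -/
theorem sum_univ_val_mul_eq_sum_range {M : Type*} [AddCommMonoid M] (G : ℕ → M) {w : ZMod L}
    (hw : w ≠ 0) : ∑ b : ZMod L, G ((b * w).val) = ∑ j ∈ range L, G j := by
  classical
  have hL : 0 < L := (Fact.out : L.Prime).pos
  have h1 : ∑ b : ZMod L, G ((b * w).val) = ∑ b : ZMod L, G (b.val) :=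
    Equiv.sum_comp (Equiv.mulRight₀ w hw) (fun b => G (b.val))
  rw [h1]
  refine Finset.sum_nbij' (fun b : ZMod L => b.val) (fun j : ℕ => (j : ZMod L)) ?_ ?_ ?_ ?_ ?_
  · intro b _; exact Finset.mem_range.2 (ZMod.val_lt b)
  · intro j _; exact Finset.mem_univ _
  · intro b _; exact ZMod.natCast_zmod_val b
  · intro j hj; exact ZMod.val_natCast_of_lt (Finset.mem_range.1 hj)
  · intro b _; rfl

end Sums

/-! ### §2 Square-free levels in CRT coordinates -/

section Coordinates

variable {ι : Type*} [DecidableEq ι] (ℓ : ι → ℕ) [hℓ : ∀ i, Fact (ℓ i).Prime]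

/-- The level `n_U = Π_{i ∈ U} ℓ_i`. [folklore] -/
def levelOf (U : Finset ι) : ℕ := ∏ i ∈ U, ℓ i

omit [DecidableEq ι] in
/-- `n_U > 0`. [folklore] -/
theorem levelOf_pos (U : Finset ι) : 0 < levelOf ℓ U :=
  Finset.prod_pos fun i _ => (hℓ i).out.pos

omit hℓ in
/-- `ℓ_i · n_{U∖i} = n_U` for `i ∈ U`. [folklore] -/
theorem mul_levelOf_erase {U : Finset ι} {i : ι} (hi : i ∈ U) :
    ℓ i * levelOf ℓ (U.erase i) = levelOf ℓ U :=
  Finset.mul_prod_erase U ℓ hi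

omit [DecidableEq ι] in
/-- Distinct primes of the family are distinct modulo each other: `ℓ_i ≢ 0 (mod ℓ_j)` for `j ≠ i`
(`ℓ` injective). [folklore] -/
theorem natCast_ne_zero_of_ne (hinj : Function.Injective ℓ) {i j : ι} (h : j ≠ i) :
    ((ℓ i : ℕ) : ZMod (ℓ j)) ≠ 0 := by
  rw [Ne, ZMod.natCast_eq_zero_iff]
  intro hdvd
  exact h (hinj ((Nat.prime_dvd_prime_iff_eq (hℓ j).out (hℓ i).out).mp hdvd))

omit [DecidableEq ι] in
/-- `n_{U'} ≢ 0 (mod ℓ_i)` when `i ∉ U'`. [folklore] -/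
theorem natCast_levelOf_ne_zero (hinj : Function.Injective ℓ) {U' : Finset ι} {i : ι} (hi : i ∉ U') :
    ((levelOf ℓ U' : ℕ) : ZMod (ℓ i)) ≠ 0 := by
  rw [levelOf, Nat.cast_prod, Finset.prod_ne_zero_iff]
  intro j hj
  exact natCast_ne_zero_of_ne ℓ hinj (fun h => hi (h ▸ hj))

/-- The CRT weight `w_{U,i} = (n_{U∖i})⁻¹ ∈ ℤ/ℓ_i`. [folklore] -/
def crtWeight (U : Finset ι) (i : ι) : ZMod (ℓ i) := (((levelOf ℓ (U.erase i) : ℕ) : ZMod (ℓ i)))⁻¹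

/-- The level-`U` argument of a tuple `a ∈ Π_i (ℤ/ℓ_i)ˣ`: the rational number
`Σ_{i ∈ U} ((a_i · w_{U,i}).val)/ℓ_i`, an explicit representative of `(CRT class of a)/n_U` modulo `ℤ`.
[folklore] -/
def levelArg (U : Finset ι) (a : Π i, (ZMod (ℓ i))ˣ) : ℚ :=
  ∑ i ∈ U, ((((a i : ZMod (ℓ i)) * crtWeight ℓ U i).val : ℕ) : ℚ) / (ℓ i : ℚ)

/-- `levelArg U a` depends only on the coordinates in `U`. [folklore] -/
theorem levelArg_congr (U : Finset ι) {a b : Π i, (ZMod (ℓ i))ˣ} (h : ∀ i ∈ U, a i = b i) :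
    levelArg ℓ U a = levelArg ℓ U b :=
  Finset.sum_congr rfl fun i hi => by rw [h i hi]

/-- `levelArg U a = z/n_U` for an integer `z` (each summand `v/ℓ_i = v·n_{U∖i}/n_U`). [folklore] -/
theorem levelArg_eq_div_levelOf (U : Finset ι) (a : Π i, (ZMod (ℓ i))ˣ) :
    ∃ z : ℤ, levelArg ℓ U a = (z : ℚ) / (levelOf ℓ U : ℚ) := by
  refine ⟨∑ i ∈ U, ((((a i : ZMod (ℓ i)) * crtWeight ℓ U i).val : ℕ) : ℤ) * (levelOf ℓ (U.erase i) : ℤ), ?_⟩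
  rw [levelArg, Int.cast_sum, Finset.sum_div]
  refine Finset.sum_congr rfl fun i hi => ?_
  have hℓi : (ℓ i : ℚ) ≠ 0 := by exact_mod_cast (hℓ i).out.ne_zero
  have hU : (levelOf ℓ U : ℚ) ≠ 0 := by exact_mod_cast (levelOf_pos ℓ U).ne'
  have hmul : (ℓ i : ℚ) * (levelOf ℓ (U.erase i) : ℚ) = levelOf ℓ U := by
    exact_mod_cast mul_levelOf_erase ℓ hi
  push_cast
  rw [div_eq_div_iff hℓi hU, ← hmul]
  ring

/-- The "Frobenius" tuple of the prime `ℓ_i`: coordinate `j ≠ i` is the unit `ℓ_i mod ℓ_j`, coordinate `i`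
is `1` (it is never read at levels not containing `i`). [folklore] -/
def frobElt (hinj : Function.Injective ℓ) (i : ι) : Π j, (ZMod (ℓ j))ˣ := fun j =>
  if h : j = i then 1 else Units.mk0 ((ℓ i : ℕ) : ZMod (ℓ j)) (natCast_ne_zero_of_ne ℓ hinj h)

/-- Coordinate `j ≠ i` of `frobElt i` is `ℓ_i mod ℓ_j`. [folklore] -/
theorem frobElt_apply_of_ne (hinj : Function.Injective ℓ) {i j : ι} (h : j ≠ i) :
    ((frobElt ℓ hinj i j : (ZMod (ℓ j))ˣ) : ZMod (ℓ j)) = ((ℓ i : ℕ) : ZMod (ℓ j)) := by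
  simp [frobElt, h]

/-- Coordinate `j ≠ i` of `(frobElt i)⁻¹` is `(ℓ_i mod ℓ_j)⁻¹`. [folklore] -/
theorem frobElt_inv_apply_of_ne (hinj : Function.Injective ℓ) {i j : ι} (h : j ≠ i) :
    (((frobElt ℓ hinj i)⁻¹ j : (ZMod (ℓ j))ˣ) : ZMod (ℓ j)) = (((ℓ i : ℕ) : ZMod (ℓ j)))⁻¹ := by
  rw [Pi.inv_apply, Units.val_inv_eq_inv_val, frobElt_apply_of_ne ℓ hinj h]

/-- **The CRT weights of consecutive levels**: for `i ∈ U` and `j ∈ U∖i`,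
`w_{U,j} = ℓ_i⁻¹ · w_{U∖i,j}` in `ℤ/ℓ_j` (`n_{U∖j} = ℓ_i · n_{(U∖i)∖j}`). [folklore] -/
theorem crtWeight_eq_inv_mul {U : Finset ι} {i j : ι} (hi : i ∈ U) (hj : j ∈ U.erase i) :
    crtWeight ℓ U j = (((ℓ i : ℕ) : ZMod (ℓ j)))⁻¹ * crtWeight ℓ (U.erase i) j := by
  have hji : j ≠ i := (Finset.mem_erase.1 hj).1
  have hi' : i ∈ U.erase j := Finset.mem_erase.2 ⟨hji.symm, hi⟩
  have h : levelOf ℓ (U.erase j) = ℓ i * levelOf ℓ ((U.erase i).erase j) := by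
    rw [← mul_levelOf_erase ℓ hi', Finset.erase_right_comm]
  rw [crtWeight, crtWeight, h, Nat.cast_mul, mul_inv]

end Coordinates

/-! ### §3 The norm relation in CRT coordinates -/

section NormRelation

variable {ι : Type*} [DecidableEq ι] (ℓ : ι → ℕ) [hℓ : ∀ i, Fact (ℓ i).Prime]
  (hinj : Function.Injective ℓ) (P : ℚ → ℚ) (hper : ∀ (r : ℚ) (z : ℤ), P (r + z) = P r)

omit [DecidableEq ι] hℓ in
include hper in
/-- `P` agrees on rationals differing by an integer. [folklore] -/
theorem apply_eq_of_sub_eq_intCast {r r' : ℚ} {z : ℤ} (h : r - r' = z) : P r = P r' := by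
  rw [show r = r' + z by rw [← h]; ring]
  exact hper r' z

/-- The level-`U` argument with the `i`-th coordinate set to an ARBITRARY residue `b` (units or not):
`X_U(c; b) = Σ_{j ∈ U∖i} ((c_j w_{U,j}).val)/ℓ_j + ((b · w_{U,i}).val)/ℓ_i`. [folklore] -/
def levelArgAt (U : Finset ι) (i : ι) (c : Π j, (ZMod (ℓ j))ˣ) (b : ZMod (ℓ i)) : ℚ :=
  ∑ j ∈ U.erase i, ((((c j : ZMod (ℓ j)) * crtWeight ℓ U j).val : ℕ) : ℚ) / (ℓ j : ℚ) +
    (((b * crtWeight ℓ U i).val : ℕ) : ℚ) / (ℓ i : ℚ)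

/-- For a unit `b`, `levelArg U (update c i b) = levelArgAt U i c b`. [folklore] -/
theorem levelArg_update {U : Finset ι} {i : ι} (hi : i ∈ U) (c : Π j, (ZMod (ℓ j))ˣ)
    (b : (ZMod (ℓ i))ˣ) :
    levelArg ℓ U (Function.update c i b) = levelArgAt ℓ U i c (b : ZMod (ℓ i)) := by
  rw [levelArg, levelArgAt, ← Finset.add_sum_erase U _ hi, add_comm]
  congr 1
  · refine Finset.sum_congr rfl fun j hj => ?_
    rw [Function.update_of_ne (Finset.mem_erase.1 hj).1]
  · rw [Function.update_self]

include hinj in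
/-- **The fibre of multiplication by `ℓ_i`.**  With `r = levelArg (U∖i) c` there is an integer `T` such
that `levelArgAt U i c b = (r + (T + (b · w_{U,i}).val))/ℓ_i` for EVERY residue `b mod ℓ_i`: the arguments
at level `U` over `c` are exactly `(r + u)/ℓ_i` with `u` running over a complete residue system. [folklore] -/
theorem exists_levelArgAt_eq {U : Finset ι} {i : ι} (hi : i ∈ U) (c : Π j, (ZMod (ℓ j))ˣ) :
    ∃ T : ℤ, ∀ b : ZMod (ℓ i), levelArgAt ℓ U i c b =
      (levelArg ℓ (U.erase i) c + ((T + ((b * crtWeight ℓ U i).val : ℕ) : ℤ) : ℚ)) / (ℓ i : ℚ) := by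
  -- for each `j ∈ U∖i`: `ℓ_i · (c_j w_{U,j}).val ≡ (c_j w_{U∖i,j}).val (mod ℓ_j)`
  have hdiv : ∀ j ∈ U.erase i, ∃ t : ℤ,
      (ℓ i : ℤ) * ((((c j : ZMod (ℓ j)) * crtWeight ℓ U j).val : ℕ) : ℤ) =
        ((((c j : ZMod (ℓ j)) * crtWeight ℓ (U.erase i) j).val : ℕ) : ℤ) + (ℓ j : ℤ) * t := by
    intro j hj
    have hji : j ≠ i := (Finset.mem_erase.1 hj).1
    have hz : (((ℓ i : ℤ) * ((((c j : ZMod (ℓ j)) * crtWeight ℓ U j).val : ℕ) : ℤ) -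
        ((((c j : ZMod (ℓ j)) * crtWeight ℓ (U.erase i) j).val : ℕ) : ℤ) : ℤ) : ZMod (ℓ j)) = 0 := by
      have hne := natCast_ne_zero_of_ne ℓ hinj hji
      push_cast
      rw [ZMod.natCast_zmod_val, ZMod.natCast_zmod_val, crtWeight_eq_inv_mul ℓ hi hj]
      calc ((ℓ i : ℕ) : ZMod (ℓ j)) * ((c j : ZMod (ℓ j)) * ((((ℓ i : ℕ) : ZMod (ℓ j)))⁻¹ *
              crtWeight ℓ (U.erase i) j)) - (c j : ZMod (ℓ j)) * crtWeight ℓ (U.erase i) j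
          = (((ℓ i : ℕ) : ZMod (ℓ j)) * (((ℓ i : ℕ) : ZMod (ℓ j)))⁻¹) *
              ((c j : ZMod (ℓ j)) * crtWeight ℓ (U.erase i) j) -
              (c j : ZMod (ℓ j)) * crtWeight ℓ (U.erase i) j := by ring
        _ = 0 := by rw [mul_inv_cancel₀ hne, one_mul, sub_self]
    rw [ZMod.intCast_zmod_eq_zero_iff_dvd] at hz
    obtain ⟨t, ht⟩ := hz
    exact ⟨t, by linarith⟩
  choose! t ht using hdiv
  refine ⟨∑ j ∈ U.erase i, t j, fun b => ?_⟩
  have hℓi : (ℓ i : ℚ) ≠ 0 := by exact_mod_cast (hℓ i).out.ne_zero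
  rw [levelArgAt, levelArg, eq_div_iff hℓi, add_mul, Finset.sum_mul]
  have hsum : ∑ j ∈ U.erase i, ((((c j : ZMod (ℓ j)) * crtWeight ℓ U j).val : ℕ) : ℚ) / (ℓ j : ℚ) * (ℓ i : ℚ)
      = ∑ j ∈ U.erase i, (((((c j : ZMod (ℓ j)) * crtWeight ℓ (U.erase i) j).val : ℕ) : ℚ) / (ℓ j : ℚ)
          + (t j : ℚ)) := by
    refine Finset.sum_congr rfl fun j hj => ?_
    have hℓj : (ℓ j : ℚ) ≠ 0 := by exact_mod_cast (hℓ j).out.ne_zero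
    have h := ht j hj
    have h' : (ℓ i : ℚ) * ((((c j : ZMod (ℓ j)) * crtWeight ℓ U j).val : ℕ) : ℚ) =
        ((((c j : ZMod (ℓ j)) * crtWeight ℓ (U.erase i) j).val : ℕ) : ℚ) + (ℓ j : ℚ) * (t j : ℚ) := by
      exact_mod_cast h
    field_simp
    linarith
  rw [hsum, Finset.sum_add_distrib, div_mul_cancel₀ _ hℓi]
  push_cast
  ring

include hinj in
/-- The argument of the NON-UNIT residue `b = 0` at level `U` over `c` is the level-`U∖i` argument of
`ℓ_i⁻¹ · c`. [folklore] -/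
theorem levelArgAt_zero {U : Finset ι} {i : ι} (hi : i ∈ U) (c : Π j, (ZMod (ℓ j))ˣ) :
    levelArgAt ℓ U i c 0 = levelArg ℓ (U.erase i) ((frobElt ℓ hinj i)⁻¹ * c) := by
  rw [levelArgAt, zero_mul, ZMod.val_zero, Nat.cast_zero, zero_div, add_zero, levelArg]
  refine Finset.sum_congr rfl fun j hj => ?_
  have hji : j ≠ i := (Finset.mem_erase.1 hj).1
  congr 3
  rw [Pi.mul_apply, Units.val_mul, frobElt_inv_apply_of_ne ℓ hinj hji, crtWeight_eq_inv_mul ℓ hi hj]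
  ring

include hinj hper in
/-- `P(ℓ_i · levelArg (U∖i) c) = P(levelArg (U∖i) (ℓ_i · c))` (the two arguments differ by an integer).
[folklore] -/
theorem apply_mul_levelArg_erase {U : Finset ι} {i : ι} (c : Π j, (ZMod (ℓ j))ˣ) :
    P ((ℓ i : ℚ) * levelArg ℓ (U.erase i) c) = P (levelArg ℓ (U.erase i) (frobElt ℓ hinj i * c)) := by
  -- per `j`: `ℓ_i (c_j w_j).val ≡ ((ℓ_i c_j) w_j).val (mod ℓ_j)`
  have hdiv : ∀ j ∈ U.erase i, ∃ s : ℤ,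
      (ℓ i : ℤ) * ((((c j : ZMod (ℓ j)) * crtWeight ℓ (U.erase i) j).val : ℕ) : ℤ) =
        (((((frobElt ℓ hinj i * c) j : (ZMod (ℓ j))ˣ) : ZMod (ℓ j)) * crtWeight ℓ (U.erase i) j).val : ℕ)
          + (ℓ j : ℤ) * s := by
    intro j hj
    have hji : j ≠ i := (Finset.mem_erase.1 hj).1
    have hz : (((ℓ i : ℤ) * ((((c j : ZMod (ℓ j)) * crtWeight ℓ (U.erase i) j).val : ℕ) : ℤ) -
        ((((((frobElt ℓ hinj i * c) j : (ZMod (ℓ j))ˣ) : ZMod (ℓ j)) *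
          crtWeight ℓ (U.erase i) j).val : ℕ) : ℤ) : ℤ) : ZMod (ℓ j)) = 0 := by
      push_cast
      rw [ZMod.natCast_zmod_val, ZMod.natCast_zmod_val, Pi.mul_apply, Units.val_mul,
        frobElt_apply_of_ne ℓ hinj hji]
      ring
    rw [ZMod.intCast_zmod_eq_zero_iff_dvd] at hz
    obtain ⟨s, hs⟩ := hz
    exact ⟨s, by linarith⟩
  choose! s hs using hdiv
  apply apply_eq_of_sub_eq_intCast P hper (z := ∑ j ∈ U.erase i, s j)
  rw [levelArg, levelArg, Finset.mul_sum, ← Finset.sum_sub_distrib, Int.cast_sum]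
  refine Finset.sum_congr rfl fun j hj => ?_
  have hℓj : (ℓ j : ℚ) ≠ 0 := by exact_mod_cast (hℓ j).out.ne_zero
  have h' : (ℓ i : ℚ) * ((((c j : ZMod (ℓ j)) * crtWeight ℓ (U.erase i) j).val : ℕ) : ℚ) =
      ((((((frobElt ℓ hinj i * c) j : (ZMod (ℓ j))ˣ) : ZMod (ℓ j)) *
        crtWeight ℓ (U.erase i) j).val : ℕ) : ℚ) + (ℓ j : ℚ) * (s j : ℚ) := by
    exact_mod_cast hs j hj
  rw [← mul_div_assoc, ← sub_div, div_eq_iff hℓj, h']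
  ring

include hinj hper in
/-- **THE NORM RELATION IN CRT COORDINATES.**  For `i ∈ U`, any tuple `c`, and the Hecke relation of `P`
at the prime `ℓ_i` with eigenvalue `A`:
`Σ_{b ∈ (ℤ/ℓ_i)ˣ} P(levelArg U (c with c_i := b)) = A·P(levelArg (U∖i) c) − P(levelArg (U∖i) (ℓ_i·c)) − P(levelArg (U∖i) (ℓ_i⁻¹·c))`
(Mazur–Tate 1987 §1.3: the image of `θ_{n_U}` at level `n_{U∖i}` is `(a_ℓ − σ_ℓ − σ_ℓ⁻¹)θ_{n_{U∖i}}`).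
[cite: Kim2022StructureSelmer, §1.4.3 (PDF p. 7)] -/
theorem sum_units_levelArg_update {U : Finset ι} {i : ι} (hi : i ∈ U) {A : ℤ}
    (hhecke : ∀ r : ℚ, (A : ℚ) * P r =
      ∑ j : Fin (ℓ i), P ((r + ((j : ℕ) : ℚ)) / (ℓ i : ℚ)) + P ((ℓ i : ℚ) * r))
    (c : Π j, (ZMod (ℓ j))ˣ) :
    ∑ b : (ZMod (ℓ i))ˣ, P (levelArg ℓ U (Function.update c i b)) =
      A * P (levelArg ℓ (U.erase i) c) - P (levelArg ℓ (U.erase i) (frobElt ℓ hinj i * c)) -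
        P (levelArg ℓ (U.erase i) ((frobElt ℓ hinj i)⁻¹ * c)) := by
  obtain ⟨T, hT⟩ := exists_levelArgAt_eq ℓ hinj hi c
  have hℓi : (ℓ i : ℚ) ≠ 0 := by exact_mod_cast (hℓ i).out.ne_zero
  -- the sum over ALL residues `b` is the Hecke fibre sum
  have hw : crtWeight ℓ U i ≠ 0 :=
    inv_ne_zero (natCast_levelOf_ne_zero ℓ hinj (Finset.notMem_erase i U))
  have hall : ∑ b : ZMod (ℓ i), P (levelArgAt ℓ U i c b) =
      ∑ j : Fin (ℓ i), P ((levelArg ℓ (U.erase i) c + ((j : ℕ) : ℚ)) / (ℓ i : ℚ)) := by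
    have h1 : ∑ b : ZMod (ℓ i), P (levelArgAt ℓ U i c b) =
        ∑ b : ZMod (ℓ i), (fun m : ℕ => P ((levelArg ℓ (U.erase i) c + ((T + (m : ℤ) : ℤ) : ℚ)) /
          (ℓ i : ℚ))) ((b * crtWeight ℓ U i).val) := by
      refine Finset.sum_congr rfl fun b _ => ?_
      rw [hT b]
    rw [h1]
    rw [sum_univ_val_mul_eq_sum_range
        (fun m : ℕ => P ((levelArg ℓ (U.erase i) c + ((T + (m : ℤ) : ℤ) : ℚ)) / (ℓ i : ℚ))) hw,
      Fin.sum_univ_eq_sum_range (fun j : ℕ => P ((levelArg ℓ (U.erase i) c + ((j : ℕ) : ℚ)) / (ℓ i : ℚ)))]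
    have h2 := sum_range_comp_add_of_periodic
      (fun z : ℤ => P ((levelArg ℓ (U.erase i) c + (z : ℚ)) / (ℓ i : ℚ))) (ℓ i)
      (fun z => by
        rw [show (levelArg ℓ (U.erase i) c + ((z + (ℓ i : ℕ) : ℤ) : ℚ)) / (ℓ i : ℚ) =
            (levelArg ℓ (U.erase i) c + (z : ℚ)) / (ℓ i : ℚ) + ((1 : ℤ) : ℚ) by
          push_cast; field_simp; ring]
        exact hper _ 1) T
    simpa using h2
  -- remove the non-unit `b = 0`
  have hsplit := sum_univ_eq_zero_add_sum_units (fun b : ZMod (ℓ i) => P (levelArgAt ℓ U i c b))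
  have hunits : ∑ b : (ZMod (ℓ i))ˣ, P (levelArg ℓ U (Function.update c i b)) =
      ∑ u : (ZMod (ℓ i))ˣ, P (levelArgAt ℓ U i c u) :=
    Finset.sum_congr rfl fun b _ => by rw [levelArg_update ℓ hi c b]
  have hu : ∑ u : (ZMod (ℓ i))ˣ, P (levelArgAt ℓ U i c u) =
      ∑ b : ZMod (ℓ i), P (levelArgAt ℓ U i c b) - P (levelArgAt ℓ U i c 0) :=
    eq_sub_of_add_eq ((add_comm _ _).trans hsplit.symm)
  rw [hunits, hu, hall, levelArgAt_zero ℓ hinj hi c, ← apply_mul_levelArg_erase ℓ hinj P hper c]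
  have := hhecke (levelArg ℓ (U.erase i) c)
  linear_combination -this

end NormRelation

end Summit.BirchSwinnertonDyer.Rank1Residual.Supersingular.KuriharaTwist.Identity
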